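import Mathlib.Analysis.SpecialFunctions.Complex.Log
import Mathlib.Analysis.SpecialFunctions.Trigonometric.Bounds
import Literature.IUT.LogThetaLattice.LocalLogShells
import HarnessLib

/-!
# [IUTchIII] Proposition 1.2 (iv) at an ARCHIMEDEAN place: the concrete shadow of the Kummer/coricity
# incompatibility for the diagram (∗arc) (proof-only companion of `HolomorphicLogShells.lean`)

Mochizuki, *Inter-universal Teichmüller Theory III*, kurims manuscript (May 2020), §1, Proposition 1.2 (iv),
p. 31 l. 62–73: "The Kummer isomorphisms `Ψ_cns(†F) ⥲ Ψ_cns(†D)`; `Ψ_cns(‡F) ⥲ Ψ_cns(‡D)` … fail to be compatible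
with the [poly-]isomorphism `Ψ_cns(†D) ⥲ Ψ_cns(‡D)` of (i), relative to the diagrams (∗non), (∗arc)" [cf. [AbsTopIII]
Cor. 5.5 (iv)]. [claim: Mochizuki2012, status: disputed]

abc-iut-L6-t3's `HolomorphicLogShells.lean` (p404642) types this node at ONE nonarchimedean `v` as a CONCRETE SHADOW:
the shell arrow `log_k` is not the identity on the units (`log_ne_self_of_mem_principalUnits`, `log_one_ne_one`) —
the kernel index `DAG.N_IUTchIII_Prop1_2_iv` packages exactly these two. The printed clause also names the
ARCHIMEDEAN diagram (∗arc). In the archimedean dictionary of Definition 1.1 (ii) (abc-iut-L6-t3, `LocalLogShells.lean`,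
kurims p. 26: `k ≅ ℂ`, `𝒪_k^× = {|a| = 1}` = `arcUnits`, log-shell `I_k = {|a| ≤ π}` = `arcLogShell`, shell arrow the
universal covering `exp_k : k → k^×`) the same shadow reads: the shell arrow `exp` is NOT the identity on the units
`𝒪_k^× ⊆ I_k`, and already `exp 0 ≠ 0`. This file PROVES these two archimedean statements (elementary:
`|exp a| = e^{Re a}` forces `Re a = 0`, and then `exp (it) = it` with `|t| = 1` would force `sin t = t`, impossible for
`t ≠ 0`), completing the one-place shadow reading of Prop. 1.2 (iv) symmetrically in `v` (that the units lie in the shell,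
`arcUnits ⊆ arcLogShell`, is `arcUnits_subset_arcLogShell` in `VerticallyCoricLGPArch.lean` — cited, not restated). It adds no interface-level
statement (the poly-isomorphism language of Thm. 1.5 (iii) / `BiCoricData` is abc-iut-L6-t3's) and takes no side on
[IUTchIII] Cor. 3.12. abc-iut cell, seat abc-iut-L6-d4 (gen 4); coverage census STATUS 2026-08-26T06:40:20Z
(residual R1 of node IUTchIII:Prop1.2(iv)). PROOF-ONLY: no definitions.
-/

namespace Literature.IUT.LogThetaLattice

open Complex Set

/-- **IUTchIII:Prop1.2(iv)** (kurims p. 31), archimedean concrete shadow: the shell arrow `exp_k : I_k → k^×` of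
Definition 1.1 (ii) is NOT the identity on the units `𝒪_k^× = {|a| = 1}` (`arcUnits`) — for `|a| = 1`, `exp a ≠ a`.
(If `exp a = a` then `e^{Re a} = |a| = 1`, so `a = it` with `|t| = 1`, and `exp (it) = it` gives `sin t = t`, which
fails for `t ≠ 0`.) [claim: Mochizuki2012, status: disputed] -/
theorem exp_ne_self_of_mem_arcUnits {a : ℂ} (ha : a ∈ arcUnits) : Complex.exp a ≠ a := by
  intro h
  have hnorm : ‖a‖ = 1 := ha
  -- `|exp a| = e^{Re a} = |a| = 1` forces `Re a = 0`
  have hre : a.re = 0 := by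
    have h1 : Real.exp a.re = 1 := by rw [← Complex.norm_exp, h, hnorm]
    simpa using congrArg Real.log h1
  -- compare imaginary parts: `sin (Im a) = Im a` (since `e^{Re a} = 1`)
  have him : Real.sin a.im = a.im := by
    have h2 := congrArg Complex.im h
    rw [Complex.exp_im, hre, Real.exp_zero, one_mul] at h2
    exact h2
  -- `|Im a| = 1` since `Re a = 0` and `|a| = 1`
  have habs : |a.im| = 1 := by
    have h3 : ‖a‖ ^ 2 = a.re ^ 2 + a.im ^ 2 := by
      rw [Complex.sq_norm, Complex.normSq_apply]; ring
    rw [hnorm, hre] at h3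
    have h4 : a.im ^ 2 = 1 := by nlinarith
    have h5 : |a.im| ^ 2 = 1 := by rw [sq_abs, h4]
    nlinarith [abs_nonneg a.im]
  -- `sin t = t` with `|t| = 1` is impossible: `sin t < t` for `t > 0`, and oddness handles `t < 0`
  rcases lt_or_gt_of_ne (show a.im ≠ 0 from fun h0 => by rw [h0, abs_zero] at habs; exact zero_ne_one habs)
    with hneg | hpos
  · have hlt := Real.sin_lt (neg_pos.mpr hneg)
    rw [Real.sin_neg, him] at hlt
    exact lt_irrefl _ hlt
  · have hlt := Real.sin_lt hpos
    rw [him] at hlt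
    exact lt_irrefl _ hlt

/-- **IUTchIII:Prop1.2(iv)** (kurims p. 31), archimedean shadow, in particular at the origin of the log-shell:
`exp 0 = 1 ≠ 0` — the diagram `𝒪_k^× → I_k --exp--> k^×` versus the Kummer identification of the units does not
commute (archimedean twin of `log_one_ne_one`). [claim: Mochizuki2012, status: disputed] -/
theorem exp_zero_ne_zero : Complex.exp 0 ≠ 0 := by
  rw [Complex.exp_zero]; exact one_ne_zero

end Literature.IUT.LogThetaLattice
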